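import Summits.QuantumFields.YangMills.Theorems.EntropyBudgetEquipartitionSpecificHeatSumRule
import HarnessLib

/-!
# Route `EntropyBudgetEquipartition`, crux `EntropyBudgetTransfer` (stmt-QuantumFields-22401) — helper «equipartition of the specific heat at a nearby coupling»

HONEST LABEL: a helper toward a RECORD-label rung (R2ξ-G); nothing here bears on the Yang–Mills mass
gap itself.

Sequel of `EntropyBudgetEquipartitionSpecificHeatSumRule.lean` (the `β`-integrated specific-heat sum rule
with a power rate, `specificHeat_sumRule_of_rate`). A pinned integral pins a value:

* `integral_const_mul_inv_sq` — `∫_β^{β''} c t⁻² dt = c (β⁻¹ − β''⁻¹)`;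
* `exists_abs_sq_mul_sub_le` — real analysis: if `χ` is continuous on `[β, β'']` (`0 < β < β''`) and
  `|∫_β^{β''} χ − a (β⁻¹ − β''⁻¹)| ≤ E` (`E > 0`), then `|t² χ(t) − a| ≤ 2E/(β⁻¹ − β''⁻¹)` for some
  `t ∈ [β, β'']` (comparison with `∫ (a ± ε) t⁻²` and the intermediate value theorem);
* `exists_coupling_equipartition_of_rate` — K1's body `|f_r(β) + (3D/2) log β − K| ≤ C β^{−κ}` forces: for
  `β ≥ β₂`, eventually along the tori `Λ_{L+1}`, SOME coupling `t ∈ [β, β + β·β^{−κ/4}]` has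
  `|t² · |Λ_{L+1}|⁻¹ Var_{t,L+1}(S_W) − 3D/2| ≤ C'' β^{−κ/4}` — the specific heat per site takes the free-gluon
  (equipartition) value `3D/(2t²)` up to a power at a coupling within `β^{1−κ/4}` of every large `β`
  (short window `β'' = β(1 + β^{−κ/4})` in the sum rule; continuity of the specific heat in the coupling,
  `continuous_variance_wilsonAction`). Pointwise-in-`β` equipartition is NOT claimed (the second derivatives
  of convex functions close in sup norm need not be close).

The unconditional form (every compact simple `G`, via the closed crux `freeEnergyRate_proof`) is in
`EntropyBudgetEquipartitionSpecificHeatSumRuleAllGroups.lean`.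

References: S. Friedli, Y. Velenik, *Statistical Mechanics of Lattice Systems*, CUP 2017, §3.2 and
Thm. 3.34; S. Chatterjee, arXiv:1602.01222. [FriedliVelenik2017] [arXiv160201222]
-/

noncomputable section

namespace Summit.QuantumFields.YangMills.Theorems.EntropyBudgetEquipartition.SpecificHeat

open MeasureTheory ProbabilityTheory Filter Topology Set
open Literature.MathematicalPhysics.QuantumLattice Literature.MathematicalPhysics.QuantumFieldTheory

/-! ### A pinned integral pins a value -/

section Real

/-- The integral of `c · t⁻²` over `[β, β'']` (`0 < β ≤ β''`) is `c (β⁻¹ − β''⁻¹)`. [folklore] -/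
theorem integral_const_mul_inv_sq {β β'' : ℝ} (hβ : 0 < β) (hββ : β ≤ β'') (c : ℝ) :
    ∫ t in β..β'', c * (t ^ 2)⁻¹ = c * (β⁻¹ - β''⁻¹) := by
  have hne : ∀ x ∈ uIcc β β'', x ≠ 0 := fun x hx => by
    rw [uIcc_of_le hββ] at hx
    exact (lt_of_lt_of_le hβ hx.1).ne'
  have hderiv : ∀ x ∈ uIcc β β'', HasDerivAt (fun y : ℝ => -y⁻¹) ((x ^ 2)⁻¹) x := fun x hx => by
    have h := (hasDerivAt_inv (hne x hx)).neg
    rwa [neg_neg] at h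
  have hcont : ContinuousOn (fun x : ℝ => (x ^ 2)⁻¹) (uIcc β β'') :=
    continuousOn_of_forall_continuousAt fun x hx =>
      ((continuous_pow 2).continuousAt).inv₀ (pow_ne_zero 2 (hne x hx))
  rw [intervalIntegral.integral_const_mul,
    intervalIntegral.integral_eq_sub_of_hasDerivAt hderiv (hcont.intervalIntegrable)]
  ring

/-- **Mean-value step (real analysis).** If `χ` is continuous on `[β, β'']` (`0 < β < β''`) and its integral
is pinned, `|∫_β^{β''} χ − a (β⁻¹ − β''⁻¹)| ≤ E` with `E > 0`, then `t² χ(t)` takes a value within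
`2E / (β⁻¹ − β''⁻¹)` of `a` at some `t ∈ [β, β'']`: otherwise `t² χ(t) − a` keeps one sign and size `> ε` on the
whole interval (intermediate value theorem), and comparing `∫ χ` with `∫ (a ± ε) t⁻²` contradicts the pin. [folklore] -/
theorem exists_abs_sq_mul_sub_le {χ : ℝ → ℝ} {β β'' a E : ℝ} (hβ : 0 < β) (hββ : β < β'')
    (hχ : ContinuousOn χ (Icc β β'')) (hE : 0 < E)
    (hI : |(∫ t in β..β'', χ t) - a * (β⁻¹ - β''⁻¹)| ≤ E) :
    ∃ t ∈ Icc β β'', |t ^ 2 * χ t - a| ≤ 2 * E / (β⁻¹ - β''⁻¹) := by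
  set m : ℝ := β⁻¹ - β''⁻¹ with hm
  have hβ''0 : 0 < β'' := hβ.trans hββ
  have hm0 : 0 < m := by
    rw [hm, sub_pos]
    exact inv_strictAnti₀ hβ hββ
  set ε : ℝ := 2 * E / m with hε
  have hεm : ε * m = 2 * E := by rw [hε]; field_simp
  have hε0 : 0 ≤ ε := by positivity
  have hIcc : uIcc β β'' = Icc β β'' := uIcc_of_lt hββ
  have hχi : IntervalIntegrable χ volume β β'' := (hIcc ▸ hχ).intervalIntegrable
  have hpos : ∀ t ∈ Icc β β'', 0 < t := fun t ht => lt_of_lt_of_le hβ ht.1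
  have hinvc : ∀ c : ℝ, IntervalIntegrable (fun t : ℝ => c * (t ^ 2)⁻¹) volume β β'' := fun c => by
    refine (continuousOn_of_forall_continuousAt fun x hx => ?_).intervalIntegrable
    rw [hIcc] at hx
    exact continuousAt_const.mul
      (((continuous_pow 2).continuousAt).inv₀ (pow_ne_zero 2 (hpos x hx).ne'))
  obtain ⟨hIl, hIu⟩ := abs_le.1 hI
  -- (1) somewhere `t² χ − a ≤ ε`
  have claim1 : ∃ t ∈ Icc β β'', t ^ 2 * χ t - a ≤ ε := by
    by_contra hcon
    push Not at hcon
    have hlow : ∀ t ∈ Icc β β'', (a + ε) * (t ^ 2)⁻¹ ≤ χ t := fun t ht => by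
      have ht2 : 0 < t ^ 2 := pow_pos (hpos t ht) 2
      rw [← div_eq_mul_inv, div_le_iff₀ ht2]
      have := hcon t ht
      linarith
    have hmono := intervalIntegral.integral_mono_on hββ.le (hinvc (a + ε)) hχi hlow
    rw [integral_const_mul_inv_sq hβ hββ.le] at hmono
    have : (a + ε) * m = a * m + 2 * E := by rw [add_mul, hεm]
    linarith
  -- (2) somewhere `−ε ≤ t² χ − a`
  have claim2 : ∃ t ∈ Icc β β'', -ε ≤ t ^ 2 * χ t - a := by
    by_contra hcon
    push Not at hcon
    have hup : ∀ t ∈ Icc β β'', χ t ≤ (a - ε) * (t ^ 2)⁻¹ := fun t ht => by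
      have ht2 : 0 < t ^ 2 := pow_pos (hpos t ht) 2
      rw [← div_eq_mul_inv, le_div_iff₀ ht2]
      have := hcon t ht
      linarith
    have hmono := intervalIntegral.integral_mono_on hββ.le hχi (hinvc (a - ε)) hup
    rw [integral_const_mul_inv_sq hβ hββ.le] at hmono
    have : (a - ε) * m = a * m - 2 * E := by rw [sub_mul, hεm]
    linarith
  -- (3) intermediate value theorem
  obtain ⟨t₁, ht₁, hg₁⟩ := claim1
  obtain ⟨t₂, ht₂, hg₂⟩ := claim2
  by_cases h₁ : -ε ≤ t₁ ^ 2 * χ t₁ - a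
  · exact ⟨t₁, ht₁, abs_le.2 ⟨h₁, hg₁⟩⟩
  by_cases h₂ : t₂ ^ 2 * χ t₂ - a ≤ ε
  · exact ⟨t₂, ht₂, abs_le.2 ⟨hg₂, h₂⟩⟩
  push Not at h₁ h₂
  have hsub : uIcc t₁ t₂ ⊆ Icc β β'' := uIcc_subset_Icc ht₁ ht₂
  have hgc : ContinuousOn (fun t : ℝ => t ^ 2 * χ t - a) (uIcc t₁ t₂) :=
    (((continuousOn_id.pow 2).mul hχ).sub continuousOn_const).mono hsub
  have h0 : (0 : ℝ) ∈ uIcc (t₁ ^ 2 * χ t₁ - a) (t₂ ^ 2 * χ t₂ - a) := by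
    rw [mem_uIcc]
    left
    constructor <;> linarith
  obtain ⟨t, ht, hgt⟩ := intermediate_value_uIcc hgc h0
  refine ⟨t, hsub ht, ?_⟩
  have hgt' : t ^ 2 * χ t - a = 0 := hgt
  rw [hgt', abs_zero]
  exact hε0

end Real

/-! ### Equipartition at a nearby coupling (`d = 4`) -/

section Rate

variable {G : Type} [Group G] [TopologicalSpace G] [IsTopologicalGroup G] [CompactSpace G]
  [MeasurableSpace G] [BorelSpace G]

/-- **Equipartition of the specific heat at a nearby coupling (conditional form).** A free-energy rate
`|f_r(β) + (3D/2) log β − K| ≤ C β^{−κ}` (`β ≥ β₀`; the body of crux `FreeEnergyRate`) forces: there are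
`C'', β₂ > 0` such that for every `β ≥ β₂`, eventually along the tori `Λ_{L+1}`, SOME coupling
`t ∈ [β, β + β·β^{−κ/4}]` has `|t² · |Λ_{L+1}|⁻¹ Var_{t,L+1}(S_W) − 3D/2| ≤ C'' β^{−κ/4}` — the specific heat per
site takes the free-gluon value `3D/(2t²)` up to a power, at a coupling within `β^{1−κ/4}` of `β`
(`specificHeat_sumRule_of_rate` on the short window, `continuous_variance_wilsonAction`, and the mean-value
step `exists_abs_sq_mul_sub_le`). Pointwise-in-`β` equipartition is NOT claimed. [cite: FriedliVelenik2017, §3.2 and Thm. 3.34] -/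
theorem exists_coupling_equipartition_of_rate (r : LatticeRep G) {D : ℕ} {K κ C β₀ : ℝ} (hκ : 0 < κ)
    (hrate : ∀ β : ℝ, β₀ ≤ β →
      |freeEnergyDensity 4 r.ρ β + (3 * (D : ℝ) / 2) * Real.log β - K| ≤ C * β ^ (-κ)) :
    ∃ C'' β₂ : ℝ, 0 < β₂ ∧ ∀ β : ℝ, β₂ ≤ β → ∀ᶠ L : ℕ in atTop, ∃ t : ℝ,
      β ≤ t ∧ t ≤ β + β * β ^ (-(κ / 4)) ∧
        |t ^ 2 * ((((L + 1 : ℕ) : ℝ) ^ 4)⁻¹ *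
            Var[wilsonAction (d := 4) (L := L + 1) (G := G) r.ρ;
              wilsonMeasure (d := 4) (L := L + 1) r.ρ t]) - 3 * (D : ℝ) / 2| ≤
          C'' * β ^ (-(κ / 4)) := by
  haveI : SecondCountableTopology (Matrix (Fin r.N) (Fin r.N) ℂ) :=
    inferInstanceAs (SecondCountableTopology (Fin r.N → Fin r.N → ℂ))
  haveI : SecondCountableTopology G :=
    (r.continuous.isClosedEmbedding r.injective).isEmbedding.secondCountableTopology
  obtain ⟨C', β₁, -, h⟩ := specificHeat_sumRule_of_rate r hκ hrate
  set Cp : ℝ := max C' 1 with hCp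
  have hCp1 : 1 ≤ Cp := le_max_right _ _
  have hC'le : C' ≤ Cp := le_max_left _ _
  refine ⟨8 * Cp, max β₁ 1, lt_of_lt_of_le one_pos (le_max_right _ _), fun β hβ => ?_⟩
  have hβ1' : β₁ ≤ β := (le_max_left _ _).trans hβ
  have hβ1 : 1 ≤ β := (le_max_right _ _).trans hβ
  have hβ0 : 0 < β := by linarith
  set δ : ℝ := β ^ (-(κ / 4)) with hδ
  have hδ0 : 0 < δ := Real.rpow_pos_of_pos hβ0 _
  have hδ1 : δ ≤ 1 := Real.rpow_le_one_of_one_le_of_nonpos hβ1 (by linarith)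
  set β'' : ℝ := β + β * δ with hβ''
  have hβδ : 0 < β * δ := mul_pos hβ0 hδ0
  have hlt : β < β'' := by rw [hβ'']; linarith
  filter_upwards [h β β'' hβ1' hlt.le] with L hL
  have hχc : Continuous fun t : ℝ => (((L + 1 : ℕ) : ℝ) ^ 4)⁻¹ *
      Var[wilsonAction (d := 4) (L := L + 1) (G := G) r.ρ;
        wilsonMeasure (d := 4) (L := L + 1) r.ρ t] :=
    continuous_const.mul (continuous_variance_wilsonAction r.ρ r.continuous)
  -- the error, weakened to `E = 2 Cp β^{-(1+κ/2)} > 0`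
  set E : ℝ := 2 * Cp * β ^ (-(1 + κ / 2)) with hE
  have hpow : 0 < β ^ (-(1 + κ / 2)) := Real.rpow_pos_of_pos hβ0 _
  have hE0 : 0 < E := by rw [hE]; positivity
  have hpow'' : β'' ^ (-(1 + κ / 2)) ≤ β ^ (-(1 + κ / 2)) :=
    Real.rpow_le_rpow_of_nonpos hβ0 hlt.le (by linarith)
  have hpow''0 : 0 ≤ β'' ^ (-(1 + κ / 2)) := Real.rpow_nonneg (by linarith) _
  have hI : |(∫ t in β..β'', (((L + 1 : ℕ) : ℝ) ^ 4)⁻¹ *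
        Var[wilsonAction (d := 4) (L := L + 1) (G := G) r.ρ;
          wilsonMeasure (d := 4) (L := L + 1) r.ρ t]) -
        3 * (D : ℝ) / 2 * (β⁻¹ - β''⁻¹)| ≤ E := by
    have h1 : (1 : ℝ) / β - 1 / β'' = β⁻¹ - β''⁻¹ := by rw [one_div, one_div]
    rw [h1] at hL
    refine hL.trans ?_
    calc C' * (β ^ (-(1 + κ / 2)) + β'' ^ (-(1 + κ / 2)))
        ≤ Cp * (β ^ (-(1 + κ / 2)) + β'' ^ (-(1 + κ / 2))) :=
          mul_le_mul_of_nonneg_right hC'le (by positivity)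
      _ ≤ Cp * (β ^ (-(1 + κ / 2)) + β ^ (-(1 + κ / 2))) :=
          mul_le_mul_of_nonneg_left (by linarith) (by linarith)
      _ = E := by rw [hE]; ring
  obtain ⟨t, ht, hg⟩ := exists_abs_sq_mul_sub_le hβ0 hlt hχc.continuousOn hE0 hI
  refine ⟨t, ht.1, ht.2, hg.trans ?_⟩
  -- `2E / (β⁻¹ − β''⁻¹) ≤ 8 Cp β^{−κ/4}`
  have hm : β⁻¹ - β''⁻¹ = δ / (β * (1 + δ)) := by
    rw [hβ'']
    field_simp
    ring
  have hmge : δ / (2 * β) ≤ β⁻¹ - β''⁻¹ := by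
    rw [hm]
    exact div_le_div_of_nonneg_left hδ0.le (by positivity) (by nlinarith)
  have hkey : β ^ (-(1 + κ / 2)) * β / δ = β ^ (-(κ / 4)) := by
    rw [hδ, ← Real.rpow_add_one hβ0.ne', ← Real.rpow_sub hβ0]
    congr 1
    ring
  calc 2 * E / (β⁻¹ - β''⁻¹) ≤ 2 * E / (δ / (2 * β)) :=
        div_le_div_of_nonneg_left (by positivity) (by positivity) hmge
    _ = 8 * Cp * (β ^ (-(1 + κ / 2)) * β / δ) := by
        rw [hE, div_div_eq_mul_div]
        ring
    _ = 8 * Cp * β ^ (-(κ / 4)) := by rw [hkey]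

end Rate

end Summit.QuantumFields.YangMills.Theorems.EntropyBudgetEquipartition.SpecificHeat

end
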